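import Summits.BirchSwinnertonDyer.Rank1Residual.Partition.MainConjecturesEisensteinTwistCertificate
import Literature.NumberTheory.EllipticCurves.NonvanishingTwistsProofs
import HarnessLib

/-!
# Row D4 ∩ {r = 1}: the twist certificate IN KEY SHAPE — an integer `d`, its Kronecker symbols, a
# model of `E^{(d)}`, and two numbers about that model

HONEST FRAMING (cell `bsd-litref`, run/shared/lean/pub/bsd-litref/; programme
`BSD-LIT2PART-PROGRAMME-v1.md` §T2d, verbatim): "no tranche here proves BSD; ARM L moves the LITERAL
column of an r ≤ 1 census into the kernel-proved-modulo-named-print column". `Proofs`-style Summits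
file: THEOREMS ONLY. Seat `bsd-litref-cgs25-pv` (prover).

`MainConjecturesEisensteinTwistCertificate` (p455255) states the per-class road for the rank-one half of
scoreboard row D4 with the auxiliary FIELD `K` as a binder (`IsImaginaryQuadratic K`, `Odd (discr K)`,
`discr K < −4`, `SatisfiesHeegnerHypothesis N_E K`, `SatisfiesHeegnerHypothesis p K`). The census lane
and the referee decide those per record on an INTEGER: the fundamental discriminant `d = d_K` (columns
`D` of `pub/bsd-litref/cgs25/offers/D4R1-TWIST/D4R1-TWIST-keys-2eng.tsv`, kit j256228 / j256354 /
j256805 / j257120 / j257650). This file re-states the SAME theorem with the field replaced by the key's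
integer data, so that every binder is literally a column of the offer:

* `RowC6.bsdp_rankOne_of_display55_of_twistShaAnUnit_key` — for `W/ℚ` globally minimal elliptic,
  `p > 2` good, `E[p]` reducible, `a_p ≢ 1 (mod p)`, `ord_{s=1}L(E,s) = 1`; an integer `d < −4` with
  `d ≡ 1 (mod 4)` squarefree (an odd negative fundamental discriminant), `(d/ℓ) = 1` for every odd
  prime `ℓ ∣ N_E·p` and `d ≡ 1 (mod 8)` if `2 ∣ N_E·p` (all of `N_E` and `p` split in `ℚ(√d)`); a
  globally minimal model `Wd` of the twist `E^{(d)}` with `L(Wd,1) ≠ 0` and `#Ш_an(Wd)` a rational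
  `p`-adic unit ⟹ `BSDp W p`. The field is PRODUCED (`exists_heegnerField_iff_exists_fundamental`,
  `QuadraticFields.Quadratic.exists_numberField_discr_eq` inside it) with `discr K = d`, and the
  `K`-form theorem applies verbatim. Named facts as there: A157 (5.5), C14 Wuthrich Prop. 21,
  modularity, Gross–Zagier (both currencies), Kolyvagin, GZK — refereed, Beilinson–Flach-free.

References: as in `MainConjecturesEisensteinTwistCertificate`; [GrossZagier1986] I.§3 (Heegner
condition as Kronecker symbols); offer `pub/bsd-litref/cgs25/offers/D4R1-TWIST/OFFER-D4R1-TWIST-v1.md`.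
-/

set_option autoImplicit false

noncomputable section

open scoped Classical

open WeierstrassCurve NumberField Literature.NumberTheory.EllipticCurves
  Literature.NumberTheory.EllipticCurves.ModularForms Literature.NumberTheory.QuadraticFields
  Literature.NumberTheory.EllipticCurves.Rank1Residual
  Literature.NumberTheory.EllipticCurves.CastellaGrossiLeeSkinner2022
  Literature.NumberTheory.EllipticCurves.Wuthrich2014

namespace Summit.BirchSwinnertonDyer.Rank1Residual

/-- **Row D4 ∩ {r = 1}, KEY SHAPE: an odd fundamental `d < −4` splitting `N_E` and `p`, a globally
minimal model `Wd` of `E^{(d)}` with `L(Wd,1) ≠ 0` and `ord_p #Ш_an(Wd) = 0` ⟹ `BSD(E,p)`.** For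
`W/ℚ` globally minimal elliptic, `p > 2` good with `E[p]` reducible and `a_p ≢ 1 (mod p)`,
`ord_{s=1}L(E,s) = 1`. The binders after the named facts are, column for column, the key of the
cell's offer D4R1-TWIST: `d` (`hd4`, `hd1`, `hsq`: `d < −4`, `d ≡ 1 (mod 4)`, squarefree), the
Kronecker conditions `hkr` at the primes of `N_E · p` (= (b) every `ℓ ∣ N_E` split and (c) `p` split,
`satisfiesHeegnerHypothesis_iff_kronecker`), the model `Wd` (`hWd`), (d) `L(E^{(d)},1) ≠ 0` read on
`Wd` (`hLd`, isomorphism invariance `entireLFunction_smul`), and the certificate `hunit`. Proof: produce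
`K = ℚ(√d)` with `discr K = d` (`exists_heegnerField_iff_exists_fundamental`) and apply
`RowC6.bsdp_rankOne_of_display55_of_twistShaAnUnit`. [cite: CastellaGrossiLeeSkinner2022, proof of Thm. 5.3.1, (5.5)–(5.7) and (a)–(d)]
[cite: Wuthrich2014, Prop. 21 (p. 400)] [cite: GrossZagier1986, I.§3 and Thm. I.7.3] [cite: Miller2011LMS, Def. 1.1] -/
theorem RowC6.bsdp_rankOne_of_display55_of_twistShaAnUnit_key (h55 : display55_sha_heegnerIndex)
    (hW : sha_dvd_analyticSha)
    (hmodP : nonempty_modularParametrizationData) (hnf : exists_isNewformOf)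
    (hGZQ : GrossZagier1986_thm_I_7_3)
    (hGZ : ∀ (N : ℕ) [NeZero N] (W : WeierstrassCurve ℚ) (K : Type) [Field K] [NumberField K],
      gross_zagier N W K)
    (hKo : ∀ (N : ℕ) [NeZero N] (W : WeierstrassCurve ℚ) (K : Type) [Field K] [NumberField K],
      kolyvagin N W K)
    (hGZK : rank_eq_analyticRank_of_analyticRank_le_one)
    (W : WeierstrassCurve ℚ) [W.IsElliptic] [W.IsGloballyMinimal] (p : ℕ) [Fact p.Prime]
    (hp : 2 < p) (hgood : Good W p) (hred : Red W p) (hna : ¬ Anom W p) (hr : W.analyticRank = 1)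
    (d : ℤ) (hd4 : d < -4) (hd1 : d % 4 = 1) (hsq : Squarefree d)
    (hkr : ∀ q : ℕ, q.Prime → q ∣ W.conductorNorm ℤ * p →
      (q = 2 → d % 8 = 1) ∧ (q ≠ 2 → jacobiSym d q = 1))
    (Wd : WeierstrassCurve ℚ) [Wd.IsElliptic] [Wd.IsGloballyMinimal]
    (hWd : ∃ C : VariableChange ℚ, C • Wd = W.quadraticTwist (d : ℚ))
    (hLd : Wd.entireLFunction 1 ≠ 0)
    (hunit : ∃ q : ℚ, shaAn Wd = (q : ℂ) ∧ padicValRat p q = 0) : BSDp W p := by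
  -- the field `K = ℚ(√d)` with `d_K = d`, Heegner for `N_E · p`, `|d_K| > 4`
  obtain ⟨K, _, _, hK, hBK, hH, hdK⟩ :=
    (exists_heegnerField_iff_exists_fundamental (W.conductorNorm ℤ * p) 4 (fun D ↦ D = d)).mpr
      ⟨d, by omega, Or.inl ⟨hd1, hsq, by omega⟩, by omega, hkr, rfl⟩
  have hodd : Odd (NumberField.discr K) := Int.odd_iff.mpr (by omega)
  have hlt : NumberField.discr K < -4 := by
    have hneg : NumberField.discr K < 0 := IsImaginaryQuadratic.discr_neg hK
    have h4 : 4 < (NumberField.discr K).natAbs := hBK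
    omega
  have hHN : SatisfiesHeegnerHypothesis (W.conductorNorm ℤ) K := hH.of_dvd (dvd_mul_right _ _)
  have hHp : SatisfiesHeegnerHypothesis p K := hH.of_dvd (dvd_mul_left _ _)
  -- the twist by `d_K` is the twist by `d`; its `L(1)` is `Wd`'s
  have hWd' : ∃ C : VariableChange ℚ, C • Wd = W.quadraticTwist (NumberField.discr K : ℚ) := by
    rw [hdK]; exact hWd
  have hLt : (W.quadraticTwist (NumberField.discr K : ℚ)).entireLFunction 1 ≠ 0 := by
    obtain ⟨C, hC⟩ := hWd'
    rw [← hC, entireLFunction_smul Wd C]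
    exact hLd
  exact RowC6.bsdp_rankOne_of_display55_of_twistShaAnUnit h55 hW hmodP hnf hGZQ hGZ hKo hGZK W p hp
    hgood hred hna hr K hK hodd hlt hHN hHp hLt Wd hWd' hunit

end Summit.BirchSwinnertonDyer.Rank1Residual

end
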